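import Summits.QuantumFields.YangMills.Theorems.FradkinShenkerFlowFiniteSusceptibilityWeakCouplingRPCauchySchwarz
import HarnessLib

/-!
# The admissible collar bump class `AdmBump` is INHABITED (vacuity guard for LINES 2/3 of ym-idea-11 g13)

`AdmBump b R₀ t` (shared verbatim by the skeletons «FloorInheritance» on `OnsetSkewLaw.RPOnsetFloor` (23138) and
«MarkovFloorInheritance» on `MarkovAtoms.OnsetFloor` (22956), and by the landed stub modules) asks for a Schwartz bump with compact
support in the box `[0,R₀]⁴` and in the open half-space `{u₀ > 0}`, non-zero integral, invariance under coordinate permutations and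
the time symmetry `u₀ ↦ t − u₀`.  The docstrings claim the witness `b(u) = ∏ₖ φ(uₖ − 4)`, `R₀ = 5`, `t = 8`; this file CHECKS it with
the explicit even profile `φ(x) = expNegInvGlue (1 − (x − 4)²)` (smooth, supported in `(3,5)`, symmetric about `4`).
So the conclusions `∃ b R₀ t, AdmBump b R₀ t ∧ …` of `stub_coarseCollarAtomRPFloor` are not vacuously unreachable.

Planner ym-idea-11 g13 (HOME `pub/ideators/ym-idea-11/g13/AdmBumpInhabited.lean`; landed verbatim + docstrings by width seat
ym-line-sfw-p2-w5 g16 on the planner's GO, cell STATUS 2026-08-29T04:23:44Z).  HONEST LABEL: a sanity lemma; proves no stub / crux / rung / summit; YM mass gap NOT proved.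
-/

set_option autoImplicit false

noncomputable section

open MeasureTheory
open scoped BigOperators ContDiff

namespace Summit.QuantumFields.YangMills.Theorems.OnsetSkewLawRPOnsetFloorAdmBump

/-- ADMISSIBLE COLLAR BUMP (verbatim from the skeletons, `E4` spelled out). -/
abbrev AdmBump (b : SchwartzMap (EuclideanSpace ℝ (Fin 4)) ℝ) (R₀ t : ℝ) : Prop :=
  HasCompactSupport b ∧ tsupport b ⊆ {u : EuclideanSpace ℝ (Fin 4) | ∀ j, 0 ≤ u j ∧ u j ≤ R₀} ∧
  tsupport b ⊆ {u : EuclideanSpace ℝ (Fin 4) | 0 < u 0} ∧ (∫ u, b u) ≠ 0 ∧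
  (∀ (π : Equiv.Perm (Fin 4)) (u : EuclideanSpace ℝ (Fin 4)), b (WithLp.toLp 2 fun i => u (π i)) = b u) ∧
  (∀ u : EuclideanSpace ℝ (Fin 4), b (WithLp.toLp 2 fun i => if i = 0 then t - u i else u i) = b u)

/-- The one-dimensional profile `φ(x) = expNegInvGlue (1 − (x − 4)²)`. [folklore] -/
def prof (x : ℝ) : ℝ := expNegInvGlue (1 - (x - 4) ^ 2)

/-- `φ` is smooth. [folklore] -/
theorem prof_contDiff : ContDiff ℝ ∞ prof :=
  expNegInvGlue.contDiff.comp (contDiff_const.sub ((contDiff_id.sub contDiff_const).pow 2))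

/-- `φ ≥ 0`. [folklore] -/
theorem prof_nonneg (x : ℝ) : 0 ≤ prof x := expNegInvGlue.nonneg _

/-- `φ` is symmetric about `4`: `φ(8 − x) = φ(x)`. [folklore] -/
theorem prof_symm (x : ℝ) : prof (8 - x) = prof x := by
  unfold prof
  congr 1
  ring

/-- `φ(4) > 0`. [folklore] -/
theorem prof_four_pos : 0 < prof 4 := expNegInvGlue.pos_of_pos (by norm_num)

/-- `φ` is supported in `(3,5)`. [folklore] -/
theorem mem_of_prof_ne_zero {x : ℝ} (h : prof x ≠ 0) : 3 < x ∧ x < 5 := by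
  by_contra hx
  apply h
  apply expNegInvGlue.zero_of_nonpos
  rw [not_and_or, not_lt, not_lt] at hx
  rcases hx with hx | hx <;> nlinarith

/-- The four-dimensional bump `b(u) = ∏ₖ φ(uₖ)`. [folklore] -/
def bumpFn (u : EuclideanSpace ℝ (Fin 4)) : ℝ := ∏ k : Fin 4, prof (u k)

/-- Coordinate projections of `ℝ⁴` are smooth. [folklore] -/
theorem contDiff_coord (k : Fin 4) : ContDiff ℝ ∞ fun u : EuclideanSpace ℝ (Fin 4) => u k :=
  (EuclideanSpace.proj (𝕜 := ℝ) k).contDiff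

/-- The bump `b` is smooth. [folklore] -/
theorem bumpFn_contDiff : ContDiff ℝ ∞ bumpFn := by
  unfold bumpFn
  exact contDiff_prod fun k _ => prof_contDiff.comp (contDiff_coord k)

/-- The bump `b` is non-negative. [folklore] -/
theorem bumpFn_nonneg (u : EuclideanSpace ℝ (Fin 4)) : 0 ≤ bumpFn u :=
  Finset.prod_nonneg fun _ _ => prof_nonneg _

/-- The bump `b` is supported in the open box `(3,5)⁴`. [folklore] -/
theorem mem_box_of_bumpFn_ne_zero {u : EuclideanSpace ℝ (Fin 4)} (h : bumpFn u ≠ 0) (j : Fin 4) :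
    3 < u j ∧ u j < 5 :=
  mem_of_prof_ne_zero (Finset.prod_ne_zero_iff.1 h j (Finset.mem_univ j))

/-- On the support of `b`, `‖u‖ ≤ 10`. [folklore] -/
theorem norm_le_of_bumpFn_ne_zero {u : EuclideanSpace ℝ (Fin 4)} (h : bumpFn u ≠ 0) : ‖u‖ ≤ 10 := by
  rw [EuclideanSpace.norm_eq]
  have hle : ∑ i : Fin 4, ‖u i‖ ^ 2 ≤ 10 ^ 2 := by
    have hb : ∀ i : Fin 4, ‖u i‖ ^ 2 ≤ 25 := fun i => by
      obtain ⟨h1, h2⟩ := mem_box_of_bumpFn_ne_zero h i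
      rw [Real.norm_eq_abs, sq_abs]
      nlinarith
    calc ∑ i : Fin 4, ‖u i‖ ^ 2 ≤ ∑ _i : Fin 4, (25 : ℝ) := Finset.sum_le_sum fun i _ => hb i
      _ = 10 ^ 2 := by simp; norm_num
  calc √(∑ i : Fin 4, ‖u i‖ ^ 2) ≤ √(10 ^ 2) := Real.sqrt_le_sqrt hle
    _ = 10 := Real.sqrt_sq (by norm_num)

/-- The bump `b` has compact support. [folklore] -/
theorem bumpFn_hasCompactSupport : HasCompactSupport bumpFn := by
  refine HasCompactSupport.intro (isCompact_closedBall (0 : EuclideanSpace ℝ (Fin 4)) 10) fun u hu => ?_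
  by_contra h
  exact hu (Metric.mem_closedBall.2 (by simpa [dist_zero_right] using norm_le_of_bumpFn_ne_zero h))

/-- The bump `b` is continuous. [folklore] -/
theorem bumpFn_continuous : Continuous bumpFn := bumpFn_contDiff.continuous

/-- `tsupport b ⊆ [3,5]⁴`. [folklore] -/
theorem tsupport_bumpFn_subset :
    tsupport bumpFn ⊆ {u : EuclideanSpace ℝ (Fin 4) | ∀ j, 3 ≤ u j ∧ u j ≤ 5} := by
  have hK : IsClosed {u : EuclideanSpace ℝ (Fin 4) | ∀ j, 3 ≤ u j ∧ u j ≤ 5} := by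
    have : {u : EuclideanSpace ℝ (Fin 4) | ∀ j, 3 ≤ u j ∧ u j ≤ 5} =
        ⋂ j : Fin 4, (fun u : EuclideanSpace ℝ (Fin 4) => u j) ⁻¹' Set.Icc 3 5 := by
      ext u
      simp [Set.mem_iInter]
    rw [this]
    exact isClosed_iInter fun j => isClosed_Icc.preimage (EuclideanSpace.proj j).continuous
  refine closure_minimal (fun u hu j => ?_) hK
  obtain ⟨h1, h2⟩ := mem_box_of_bumpFn_ne_zero (Function.mem_support.1 hu) j
  exact ⟨h1.le, h2.le⟩

/-- The Schwartz map with underlying function `bumpFn`. [folklore] -/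
def bump : SchwartzMap (EuclideanSpace ℝ (Fin 4)) ℝ := bumpFn_hasCompactSupport.toSchwartzMap bumpFn_contDiff

/-- The Schwartz bump evaluates as `bumpFn`. [folklore] -/
theorem bump_apply (u : EuclideanSpace ℝ (Fin 4)) : bump u = bumpFn u := rfl

/-- The Schwartz bump coerces to `bumpFn`. [folklore] -/
theorem coe_bump : (bump : EuclideanSpace ℝ (Fin 4) → ℝ) = bumpFn := rfl

/-- **`AdmBump` is inhabited**: `b = ∏ₖ φ(uₖ)` with `φ(x) = expNegInvGlue (1 − (x−4)²)`, `R₀ = 5`, `t = 8`. [folklore] -/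
theorem admBump_inhabited : ∃ (b : SchwartzMap (EuclideanSpace ℝ (Fin 4)) ℝ) (R₀ t : ℝ), AdmBump b R₀ t := by
  refine ⟨bump, 5, 8, ?_, ?_, ?_, ?_, ?_, ?_⟩
  · rw [coe_bump]; exact bumpFn_hasCompactSupport
  · rw [coe_bump]
    intro u hu j
    obtain ⟨h1, h2⟩ := tsupport_bumpFn_subset hu j
    exact ⟨by linarith, h2⟩
  · rw [coe_bump]
    intro u hu
    have := (tsupport_bumpFn_subset hu 0).1
    show 0 < u 0
    linarith
  · rw [coe_bump]
    have hc : bumpFn (WithLp.toLp 2 fun _ : Fin 4 => (4 : ℝ)) ≠ 0 := by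
      simp only [bumpFn, Finset.prod_const, Finset.card_univ, Fintype.card_fin]
      exact (pow_pos prof_four_pos 4).ne'
    exact (bumpFn_continuous.integral_pos_of_hasCompactSupport_nonneg_nonzero bumpFn_hasCompactSupport
      bumpFn_nonneg hc).ne'
  · intro π u
    simp only [bump_apply, bumpFn]
    exact Equiv.prod_comp π (fun i => prof (u i))
  · intro u
    simp only [bump_apply, bumpFn]
    refine Finset.prod_congr rfl fun k _ => ?_
    split_ifs with hk
    · exact prof_symm _
    · rfl

end Summit.QuantumFields.YangMills.Theorems.OnsetSkewLawRPOnsetFloorAdmBump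

end
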